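import Literature.NumberTheory.EllipticCurves.QuadraticTwistRank
import Literature.NumberTheory.EllipticCurves.HeightsBaseChangeProofs
import Literature.NumberTheory.EllipticCurves.BSDInvariantsRegulatorProofs
import Literature.NumberTheory.EllipticCurves.BSDInvariantsProofs
import Literature.NumberTheory.EllipticCurves.RegulatorProofs
import Literature.NumberTheory.EllipticCurves.RegulatorBasisProofs
import Literature.NumberTheory.EllipticCurves.MordellWeilTheoremProofs
import Literature.NumberTheory.EllipticCurves.MordellWeilRankZeroProofs
import Literature.NumberTheory.QuadraticFields.SquareRootGenerator
import HarnessLib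

/-!
# Route `GenusKolyvaginAtTwo`, LINE 18 v4 (L_T `PowDvdShaCardAtTwoRT`, stmt-BirchSwinnertonDyer-23242),
# registered stub K `stub_genusIndexLaw` — factor (R), part 1: THE ALGEBRA OF THE RANK-ONE DESCENT
# (involution with odd torsion; one-point Mordell–Weil bases; the height pairing along `congrEquiv`)

Seat `bsd-line-gk2-p2` g14 (cell `bsd-f1-sign2`), `--supports stmt-BirchSwinnertonDyer-23242` (helper; closes
nothing).  THEOREMS ONLY (no definition, no named fact, no `sorry`); UNCONDITIONAL; BSD is not proved by any of
this.  Part 1 of 2: the pure-algebra and Mordell–Weil-basis lemmas used by the companion file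
`…GenusIndexRegulator.lean` (`Reg(W)·Reg(W^{(d_K)}) = Reg(W_K)/2`).

The pen's stub K (`plus_descent.lean` v4, 2026-08-28T23:12Z) asks for the 2-adic value of the Ш-free ratio
`ρ = B(W)·B(Wd)/B(W_K)`, `B = Reg·Ω·C/#tors²`, on the genus frame; its bullet (R) is the regulator factor:
"`E(K) ⊇ E(ℚ) + E^{d_K}(ℚ)` with 2-power index `a`, and `a = 1` here (rank `= 1`, the rank-0 summand is odd
torsion) ⇒ `Reg(W)·Reg(Wd)/Reg(W_K) = 1/2`" (heights over `K` are `K`-relative, tree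
`canonicalHeight_baseChange`: `ĥ_K = [K:ℚ]·ĥ_ℚ`).  This file proves exactly that, for ANY elliptic `W/ℚ`
and ANY quadratic number field `K` with `rank E(K) = 1` and `E(K)[2] = 0`:

* §1 pure algebra (`exists_zsmul_sub_mem_torsion_of_fixed_torsion`, `…_of_antifixed_torsion`): for an
  involution `σ` of an abelian group `M` whose fixed points come from `ι : A → M` and anti-fixed points from
  `τ : B → M` (`σι = ι`, `στ = −τ`), every torsion element of `M` having ODD order: if `A` is torsion and `R`
  generates `B` modulo torsion then `τ R` generates `M` modulo torsion (and symmetrically) — the "odd torsion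
  can be halved" trick `x ↦ x + k·ι(a)`, `(2k+1)·ι(a) = 0`;
* §2 Mordell–Weil bases with one element (`isMordellWeilBasis_single_iff`, `regulatorOf_fin_one`) and the
  transport of the Néron–Tate pairing along `congrEquiv` / the twisting map `τ`
  (`heightPairing_twistMap`: `⟨τR, τR⟩_K = 2⟨R, R⟩_ℚ`, Silverman VIII.5.4(b) + VIII.9.1);
* §3 **`regulator_mul_regulator_quadraticTwist_eq_half`**: `[K:ℚ] = 2`, `rank_ℤ E(K) = 1`, `E(K)[2] = 0` ⇒
  `Reg(W)·Reg(W^{(d_K)}) = Reg(W_K)/2`; by Silverman Exercise 10.16 (tree `QuadraticTwistRank`) exactly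
  one of `E(ℚ)`, `E^{(d_K)}(ℚ)` has rank one, its generator `R` gives the Mordell–Weil basis `{ι R}` resp.
  `{τ R}` of `E(K)` (§1: the other summand is ODD torsion, so the index `[E(K) : E(ℚ) + E^{d_K}(ℚ)]` is odd,
  not merely a power of `2`), and `⟨·,·⟩_K = 2⟨·,·⟩_ℚ`; the rank-0 factor is `1`
  (`regulator_eq_one_of_rank_zero`);
* §4 `regulator_mul_regulator_eq_half_of_twist`: the same for ANY model `Wd = C • W^{(d_K)}`
  (`regulator_variableChange_holds`).

References: [SilvermanAEC2009] VIII.5.4(b), VIII.9 (Thm. 9.3, definition of `R_{E/K}`), Exercise 10.16;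
[Kramer1981] Thm. 1 (the index `[E(K) : E(ℚ) + E^{D}(ℚ)]`); [GrossZagier1986] V.§2 (p. 313: `ĥ_K = 2ĥ_ℚ`);
[DokchitserDokchitserAnnals2010] Conj. 2.1 (the `K`-relative regulator in the BSD quotient).
-/

set_option autoImplicit false
-- the Theorems namespace of this sub repeats the summit name by design (D-0017 nested layout)
set_option linter.dupNamespace false

noncomputable section

open scoped Classical

namespace Summit.BirchSwinnertonDyer.BirchSwinnertonDyer.Theorems.GenusExact.PlusDescent

open WeierstrassCurve WeierstrassCurve.QuadraticDescent Module
  Literature.NumberTheory.QuadraticFields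

/-! ## §1 Pure algebra: descent of a rank-one lattice through an involution with odd torsion -/

section Algebra

variable {A B M : Type*} [AddCommGroup A] [AddCommGroup B] [AddCommGroup M]

/-- In an abelian group without elements of order `2`, every torsion element is killed by an ODD integer:
`∃ k, (2k+1)·y = 0`. [folklore] -/
theorem exists_two_mul_add_one_nsmul_eq_zero (h2 : ∀ x : M, 2 • x = 0 → x = 0) {y : M}
    (hy : IsOfFinAddOrder y) : ∃ k : ℕ, (2 * k + 1) • y = 0 := by
  set m := addOrderOf y with hm
  have hm0 : 0 < m := hy.addOrderOf_pos
  rcases Nat.even_or_odd m with ⟨k, hk⟩ | ⟨k, hk⟩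
  · exfalso
    have hk0 : 0 < k := by omega
    have hz : k • y = 0 := by
      apply h2
      rw [← mul_nsmul', show 2 * k = m by omega]
      exact addOrderOf_nsmul_eq_zero y
    have hdvd : m ∣ k := addOrderOf_dvd_of_nsmul_eq_zero hz
    have := Nat.le_of_dvd hk0 hdvd
    omega
  · exact ⟨k, by rw [← hk]; exact addOrderOf_nsmul_eq_zero y⟩

/-- **Descent through an involution, torsion on the FIXED side.**  `σ` an involution of `M` with
`σ ∘ ι = ι`, `σ ∘ τ = −τ`, fixed points in `im ι`, anti-fixed points in `im τ`, `M` without `2`-torsion;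
if `A` is torsion and `R` generates `B` modulo torsion, then `τ R` generates `M` modulo torsion:
for `x ∈ M`, `x + σx = ι a` with `(2k+1)ι a = 0`, so `x + k·ι a` is anti-fixed, `= τ b`, `b ≡ nR`.
(Silverman, *AEC*, Exercise 10.16: the eigenspace decomposition of `E(K)` under `Gal(K/F)`, integrally.)
[cite: SilvermanAEC2009, Exercise 10.16] -/
theorem exists_zsmul_sub_mem_torsion_of_fixed_torsion (ι : A →+ M) (τ : B →+ M) (σ : M →+ M)
    (hσσ : ∀ x, σ (σ x) = x) (hσι : ∀ a, σ (ι a) = ι a)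
    (hfix : ∀ x, σ x = x → x ∈ ι.range) (hanti : ∀ x, σ x = -x → x ∈ τ.range)
    (h2 : ∀ x : M, 2 • x = 0 → x = 0) (hA : ∀ a : A, IsOfFinAddOrder a) (R : B)
    (hR : ∀ b : B, ∃ n : ℤ, b - n • R ∈ AddCommGroup.torsion B) (x : M) :
    ∃ n : ℤ, x - n • τ R ∈ AddCommGroup.torsion M := by
  obtain ⟨a, ha⟩ := hfix (x + σ x) (by rw [map_add, hσσ, add_comm])
  have hιa : IsOfFinAddOrder (ι a) := ι.isOfFinAddOrder (hA a)
  obtain ⟨k, hk⟩ := exists_two_mul_add_one_nsmul_eq_zero h2 hιa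
  set x' := x + k • ι a with hx'
  have hx'anti : σ x' = -x' := by
    have h1 : σ x' = σ x + k • ι a := by rw [hx', map_add, map_nsmul, hσι]
    have h0 : x + σ x + (2 * k) • ι a = 0 := by
      rw [← ha, add_comm]
      rwa [add_nsmul, one_nsmul] at hk
    rw [h1, hx', neg_add, ← sub_eq_zero]
    have : σ x + k • ι a - (-x + -(k • ι a)) = x + σ x + (2 * k) • ι a := by
      rw [mul_nsmul', two_nsmul]; abel
    rw [this, h0]
  obtain ⟨b, hb⟩ := hanti x' hx'anti
  obtain ⟨n, hn⟩ := hR b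
  refine ⟨n, ?_⟩
  have hx : x - n • τ R = τ (b - n • R) - k • ι a := by
    rw [map_sub, map_zsmul, hb, hx']; abel
  rw [hx]
  refine sub_mem ?_ (AddSubgroup.nsmul_mem _ ?_ k)
  · exact (AddCommGroup.mem_torsion _).mpr (τ.isOfFinAddOrder ((AddCommGroup.mem_torsion _).mp hn))
  · exact (AddCommGroup.mem_torsion _).mpr hιa

/-- **Descent through an involution, torsion on the ANTI-FIXED side.**  Same setting; if `B` is torsion
and `R` generates `A` modulo torsion, then `ι R` generates `M` modulo torsion: `x − σx = τ b` with
`(2k+1)τ b = 0`, so `x + k·τ b` is fixed, `= ι a`, `a ≡ nR`.  [cite: SilvermanAEC2009, Exercise 10.16] -/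
theorem exists_zsmul_sub_mem_torsion_of_antifixed_torsion (ι : A →+ M) (τ : B →+ M) (σ : M →+ M)
    (hσσ : ∀ x, σ (σ x) = x) (hστ : ∀ b, σ (τ b) = -τ b)
    (hfix : ∀ x, σ x = x → x ∈ ι.range) (hanti : ∀ x, σ x = -x → x ∈ τ.range)
    (h2 : ∀ x : M, 2 • x = 0 → x = 0) (hB : ∀ b : B, IsOfFinAddOrder b) (R : A)
    (hR : ∀ a : A, ∃ n : ℤ, a - n • R ∈ AddCommGroup.torsion A) (x : M) :
    ∃ n : ℤ, x - n • ι R ∈ AddCommGroup.torsion M := by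
  obtain ⟨b, hb⟩ := hanti (x - σ x) (by rw [map_sub, hσσ, neg_sub])
  have hτb : IsOfFinAddOrder (τ b) := τ.isOfFinAddOrder (hB b)
  obtain ⟨k, hk⟩ := exists_two_mul_add_one_nsmul_eq_zero h2 hτb
  set x' := x + k • τ b with hx'
  have hx'fix : σ x' = x' := by
    have h1 : σ x' = σ x - k • τ b := by
      rw [hx', map_add, map_nsmul, hστ, smul_neg, ← sub_eq_add_neg]
    have h0 : x - σ x + (2 * k) • τ b = 0 := by
      rw [← hb, add_comm]
      rwa [add_nsmul, one_nsmul] at hk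
    rw [h1, hx', ← sub_eq_zero]
    have : σ x - k • τ b - (x + k • τ b) = -(x - σ x + (2 * k) • τ b) := by
      rw [mul_nsmul', two_nsmul]; abel
    rw [this, h0, neg_zero]
  obtain ⟨a, ha⟩ := hfix x' hx'fix
  obtain ⟨n, hn⟩ := hR a
  refine ⟨n, ?_⟩
  have hx : x - n • ι R = ι (a - n • R) - k • τ b := by
    rw [map_sub, map_zsmul, ha, hx']; abel
  rw [hx]
  refine sub_mem ?_ (AddSubgroup.nsmul_mem _ ?_ k)
  · exact (AddCommGroup.mem_torsion _).mpr (ι.isOfFinAddOrder ((AddCommGroup.mem_torsion _).mp hn))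
  · exact (AddCommGroup.mem_torsion _).mpr hτb

/-- Elements of a torsion-free-mod-torsion description: if `M` has no `2`-torsion and `f : N →+ M` is
injective, then `N` has no `2`-torsion. [folklore] -/
theorem forall_two_nsmul_eq_zero_of_injective {N : Type*} [AddCommGroup N] (f : N →+ M)
    (hf : Function.Injective f) (h2 : ∀ x : M, 2 • x = 0 → x = 0) (y : N) (hy : 2 • y = 0) : y = 0 :=
  hf (by rw [map_zero]; exact h2 _ (by rw [← map_nsmul, hy, map_zero]))

end Algebra

/-! ## §2 One-element Mordell–Weil bases; the height pairing along `congrEquiv` and the twisting map -/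

section MordellWeil

variable {F : Type*} [Field F] {V : WeierstrassCurve F}

/-- A single point `g` is a Mordell–Weil basis iff it is non-torsion and generates `E(F)` modulo torsion.
(Silverman, *AEC* VIII.6; Cremona §3.5.) [folklore] -/
theorem isMordellWeilBasis_single_iff (g : V.toAffine.Point) :
    IsMordellWeilBasis ![g] ↔
      g ∉ AddCommGroup.torsion V.toAffine.Point ∧
        ∀ x : V.toAffine.Point, ∃ n : ℤ, x - n • g ∈ AddCommGroup.torsion V.toAffine.Point := by
  have hrange : Set.range (QuotientAddGroup.mk ∘ ![g] : Fin 1 → mordellWeilModTorsion V) =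
      {(QuotientAddGroup.mk g : mordellWeilModTorsion V)} := by
    ext y
    simp only [Set.mem_range, Function.comp_apply, Set.mem_singleton_iff]
    constructor
    · rintro ⟨i, rfl⟩
      fin_cases i; rfl
    · rintro rfl; exact ⟨0, rfl⟩
  have hmem : ∀ x : V.toAffine.Point, ∀ n : ℤ,
      (x - n • g ∈ AddCommGroup.torsion V.toAffine.Point ↔
        n • (QuotientAddGroup.mk g : mordellWeilModTorsion V) = QuotientAddGroup.mk x) := by
    intro x n
    rw [← QuotientAddGroup.eq_zero_iff, QuotientAddGroup.mk_sub, QuotientAddGroup.mk_zsmul, sub_eq_zero,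
      eq_comm]
  constructor
  · rintro ⟨hli, hsp⟩
    refine ⟨?_, fun x => ?_⟩
    · intro hg
      have h0 : (QuotientAddGroup.mk ∘ ![g] : Fin 1 → mordellWeilModTorsion V) 0 = 0 := by
        simpa using (QuotientAddGroup.eq_zero_iff g).mpr hg
      exact hli.ne_zero 0 h0
    · have hx : (QuotientAddGroup.mk x : mordellWeilModTorsion V) ∈
          Submodule.span ℤ (Set.range (QuotientAddGroup.mk ∘ ![g] : Fin 1 → mordellWeilModTorsion V)) := by
        rw [hsp]; exact Submodule.mem_top
      rw [hrange, Submodule.mem_span_singleton] at hx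
      obtain ⟨n, hn⟩ := hx
      exact ⟨n, (hmem x n).mpr hn⟩
  · rintro ⟨hg, hsp⟩
    refine ⟨?_, ?_⟩
    · rw [linearIndependent_unique_iff]
      simpa using fun h => hg ((QuotientAddGroup.eq_zero_iff g).mp h)
    · rw [hrange, Submodule.eq_top_iff']
      intro y
      obtain ⟨x, rfl⟩ := QuotientAddGroup.mk_surjective y
      obtain ⟨n, hn⟩ := hsp x
      exact Submodule.mem_span_singleton.mpr ⟨n, (hmem x n).mp hn⟩

/-- From a Mordell–Weil basis indexed by `Fin 1`: the point is non-torsion and generates modulo torsion.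
[folklore] -/
theorem exists_zsmul_sub_mem_torsion_of_isMordellWeilBasis_fin_one {P : Fin 1 → V.toAffine.Point}
    (hP : IsMordellWeilBasis P) :
    P 0 ∉ AddCommGroup.torsion V.toAffine.Point ∧
      ∀ x : V.toAffine.Point, ∃ n : ℤ, x - n • P 0 ∈ AddCommGroup.torsion V.toAffine.Point := by
  have hP' : P = ![P 0] := by
    funext i; fin_cases i; rfl
  rw [hP'] at hP
  exact (isMordellWeilBasis_single_iff (P 0)).mp hP

/-- Reindexing a Mordell–Weil basis along a bijection of index types. [folklore] -/
theorem isMordellWeilBasis_comp_equiv {ι κ : Type*} {P : ι → V.toAffine.Point} (hP : IsMordellWeilBasis P)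
    (e : κ ≃ ι) : IsMordellWeilBasis (P ∘ e) := by
  refine ⟨?_, ?_⟩
  · have h : (QuotientAddGroup.mk ∘ (P ∘ e) : κ → mordellWeilModTorsion V) = (QuotientAddGroup.mk ∘ P) ∘ e :=
      rfl
    rw [h]
    exact hP.1.comp e e.injective
  · have h : (QuotientAddGroup.mk ∘ (P ∘ e) : κ → mordellWeilModTorsion V) = (QuotientAddGroup.mk ∘ P) ∘ e :=
      rfl
    rw [h, e.surjective.range_comp]
    exact hP.2

/-- In rank `1` over a number field there is a one-point Mordell–Weil basis. [cite: SilvermanAEC2009, VIII.6] -/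
theorem exists_isMordellWeilBasis_single {K : Type*} [Field K] [NumberField K] (X : WeierstrassCurve K)
    [X.IsElliptic] (h : X.mordellWeilRank = 1) : ∃ g : X.toAffine.Point, IsMordellWeilBasis ![g] := by
  obtain ⟨P, hP⟩ := X.exists_isMordellWeilBasis_holds
  refine ⟨P (finCongr h.symm 0), ?_⟩
  have hfun : (![P (finCongr h.symm 0)] : Fin 1 → X.toAffine.Point) = P ∘ finCongr h.symm := by
    funext i
    fin_cases i
    rfl
  rw [hfun]
  exact isMordellWeilBasis_comp_equiv hP _

/-- In rank `0` over a number field every point is torsion. [cite: SilvermanAEC2009, VIII.6] -/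
theorem forall_isOfFinAddOrder_of_mordellWeilRank_eq_zero {K : Type*} [Field K] [NumberField K]
    (X : WeierstrassCurve K) [X.IsElliptic] (h : X.mordellWeilRank = 0) (P : X.toAffine.Point) :
    IsOfFinAddOrder P := by
  haveI := X.finite_point_of_rank_zero h
  exact isOfFinAddOrder_of_finite P

end MordellWeil

section Heights

variable {K : Type*} [Field K] [Height.AdmissibleAbsValues K]

/-- The regulator of a one-point family is its self-pairing: `Reg(P) = ⟨P₀, P₀⟩`. [folklore] -/
theorem regulatorOf_fin_one {V : WeierstrassCurve K} (P : Fin 1 → V.toAffine.Point) :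
    regulatorOf P = Affine.Point.heightPairing (P 0) (P 0) := by
  rw [regulatorOf, Matrix.det_unique, heightPairingMatrix_apply]
  rfl

/-- The Néron–Tate pairing is unchanged by transport along an EQUALITY of Weierstrass equations
(`congrEquiv`, the identity on coordinates). [folklore] -/
theorem heightPairing_congrEquiv {V₁ V₂ : WeierstrassCurve K} (h : V₁ = V₂) (P Q : V₁.toAffine.Point) :
    Affine.Point.heightPairing (Affine.Point.congrEquiv h P) (Affine.Point.congrEquiv h Q) =
      Affine.Point.heightPairing P Q := by
  subst h
  rfl

end Heights

end Summit.BirchSwinnertonDyer.BirchSwinnertonDyer.Theorems.GenusExact.PlusDescent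

end
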